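import Summits.NavierStokesRegularity.NavierStokesRegularity.Theorems.RellichScarScarRigidityRotationGeneratorFlat
import Literature.Analysis.FluidPDE.IsometryInvariance
import Literature.Analysis.FluidPDE.ClassicalSolutionCalculus
import HarnessLib

/-!
# `ScarRigidity` — line `SketchIdeator6` (skeleton v2, linear route), stub P1
# `stub_rotationGeneratorSolvesLinearised` (crux stmt-NavierStokesRegularity-11717, route RellichScar)

**P1 — the rotation generator solves the linearised Navier–Stokes system.**  For a classical solution
`(V, Q)` of Navier–Stokes on the open backward slab `(−∞,0) × ℝ³`, the ROTATION GENERATOR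
`r(t,x) = J V(t,x) − ∇V(t,x)·(J x)` (`J = rotGen = (d/dθ) R_θ|₀`, `R_θ = rotZ θ`) with the pressure
`P_r(t,x) = −∇Q(t,x)·(J x)` is jointly smooth, divergence free, and solves
`∂ₜr + (V·∇)r + (r·∇)V = Δr − ∇P_r` pointwise on the slab.

Proof (soft, no coordinates).  `r(t,·)` and `P_r(t,·)` are the `θ`-derivatives at `θ = 0` of the rotation
conjugates `V^θ(t,x) = R_θ V(t, R_{−θ}x)`, `Q^θ(t,x) = Q(t, R_{−θ}x)` (`hasDerivAt_rotConj` of the tree), and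
`(V^θ, Q^θ)` is again a classical solution for every `θ` (isometry covariance of Navier–Stokes,
`IsClassicalNSSolutionOn.conj_linearIsometryEquiv`).  The conjugation orbit is jointly smooth in `(θ, x)` at a
fixed time and in `(t, θ)` at a fixed point, so the tree's exchange lemmas for jointly smooth two-parameter
fields (`IsSmoothSpaceTimeOn.hasDerivAt_fderiv_slice_clm`, `hasDerivAt_iteratedFDeriv_slice`,
`IsSmoothSpaceTimeOn.deriv_fderiv_slice_eq_fderiv_deriv`, with the ANGLE in the role of time) give the
`θ`-derivatives at `0` of every term of the conjugated momentum equation: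
`∂_θ ∇V^θ = ∇r`, `∂_θ ΔV^θ = Δr`, `∂_θ ∇Q^θ = ∇P_r`, `∂_θ ∂ₜV^θ = ∂ₜr` (Schwarz in `(t, θ)`), and
`∂_θ (V^θ·∇)V^θ = (V·∇)r + (r·∇)V` (product rule).  Uniqueness of the derivative of
`θ ↦ ∂ₜV^θ + (V^θ·∇)V^θ = ΔV^θ − ∇Q^θ` at `θ = 0` is the linearised equation, and differentiating
`div V^θ ≡ 0` gives `div r = 0`.
-/

noncomputable section

open Set Filter Function
open scoped Topology InnerProductSpace RealInnerProductSpace ContDiff Laplacian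

set_option linter.dupNamespace false -- D-0017: `Summit.<S>.<S>.…` repeats the summit name by design

namespace Summit.NavierStokesRegularity.NavierStokesRegularity.Theorems.RellichScarScarRigidity

open Literature.Analysis.FluidPDE

/-- Physical space (the notation of the route file, in which the registered stub below is stated). -/
local notation "ℝ³" => EuclideanSpace ℝ (Fin 3)

/-! ## Smoothness of the rotation in the angle and the vector -/

/-- Joint smoothness of the rotation about the axis in the angle and the vector: if `θ : X → ℝ` and
`W : X → ℝ³` are `Cⁿ`, so is `z ↦ R_{θ(z)} W(z)` (Rodrigues form `R_θ v = v + sin θ • Jv + (1 − cos θ) • J(Jv)`). -/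
private theorem contDiff_rotZ_angleVector {X : Type*} [NormedAddCommGroup X] [NormedSpace ℝ X]
    {n : WithTop ℕ∞} {θ : X → ℝ} {W : X → ℝ³}
    (hθ : ContDiff ℝ n θ) (hW : ContDiff ℝ n W) :
    ContDiff ℝ n (fun z => rotZ (θ z) (W z)) := by
  have e : (fun z => rotZ (θ z) (W z)) = fun z =>
      W z + Real.sin (θ z) • rotGenL (W z) + (1 - Real.cos (θ z)) • rotGenL (rotGenL (W z)) :=
    funext fun z => rotZ_eq_rotGen_expand _ _
  rw [e]
  have hJ : ContDiff ℝ n (fun z => rotGenL (W z)) := rotGenL.contDiff.comp hW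
  have hJJ : ContDiff ℝ n (fun z => rotGenL (rotGenL (W z))) := rotGenL.contDiff.comp hJ
  exact (hW.add ((Real.contDiff_sin.comp hθ).smul hJ)).add
    ((contDiff_const.sub (Real.contDiff_cos.comp hθ)).smul hJJ)

/-- `ContDiffOn` form of `contDiff_rotZ_angleVector`: `z ↦ R_{θ(z)} W(z)` is `Cⁿ` on `s` if `θ`, `W` are. -/
private theorem contDiffOn_rotZ_angleVector {X : Type*} [NormedAddCommGroup X] [NormedSpace ℝ X]
    {n : WithTop ℕ∞} {θ : X → ℝ} {W : X → ℝ³} {s : Set X}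
    (hθ : ContDiffOn ℝ n θ s) (hW : ContDiffOn ℝ n W s) :
    ContDiffOn ℝ n (fun z => rotZ (θ z) (W z)) s := by
  have e : (fun z => rotZ (θ z) (W z)) = fun z =>
      W z + Real.sin (θ z) • rotGenL (W z) + (1 - Real.cos (θ z)) • rotGenL (rotGenL (W z)) :=
    funext fun z => rotZ_eq_rotGen_expand _ _
  rw [e]
  have hJ : ContDiffOn ℝ n (fun z => rotGenL (W z)) s := rotGenL.contDiff.comp_contDiffOn hW
  have hJJ : ContDiffOn ℝ n (fun z => rotGenL (rotGenL (W z))) s :=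
    rotGenL.contDiff.comp_contDiffOn hJ
  exact (hW.add ((Real.contDiff_sin.comp_contDiffOn hθ).smul hJ)).add
    ((contDiffOn_const.sub (Real.contDiff_cos.comp_contDiffOn hθ)).smul hJJ)

/-! ## The conjugation orbit at the identity: the rotation generator -/

/-- **The rotation generator is the velocity of the conjugation orbit at the identity**:
`(d/dθ)|₀ R_θ f(R_{−θ} y) = J f(y) − Df(y)[J y]`. -/
theorem hasDerivAt_rotConj_zero {f : ℝ³ → ℝ³} (y : ℝ³) (hf : DifferentiableAt ℝ f y) :
    HasDerivAt (fun φ => rotZ φ (f (rotZ (-φ) y))) (rotGen (f y) - fderiv ℝ f y (rotGen y)) 0 := by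
  have hf' : DifferentiableAt ℝ f (rotZ (-0) y) := by simpa using hf
  simpa using hasDerivAt_rotConj (f := f) y 0 hf'

/-- The angular derivative field at the identity of the conjugation orbit of a differentiable field is the
rotation generator `y ↦ J f(y) − Df(y)[J y]`. -/
theorem deriv_rotConj_zero_eq {f : ℝ³ → ℝ³} (hf : Differentiable ℝ f) :
    (fun y => deriv (fun φ => rotZ φ (f (rotZ (-φ) y))) 0) =
      fun y => rotGen (f y) - fderiv ℝ f y (rotGen y) :=
  funext fun y => (hasDerivAt_rotConj_zero y (hf y)).deriv

/-- **Scalar (pressure) orbit at the identity**: `(d/dθ)|₀ q(R_{−θ} y) = −Dq(y)[J y]`. -/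
theorem hasDerivAt_comp_rotZ_neg_zero {F : Type*} [NormedAddCommGroup F] [NormedSpace ℝ F]
    {q : ℝ³ → F} (y : ℝ³) (hq : DifferentiableAt ℝ q y) :
    HasDerivAt (fun φ => q (rotZ (-φ) y)) (-(fderiv ℝ q y (rotGen y))) 0 := by
  have hq' : DifferentiableAt ℝ q (rotZ (-0) y) := by simpa using hq
  have h := hq'.hasFDerivAt.comp_hasDerivAt (0 : ℝ) (hasDerivAt_rotZ_neg y 0)
  simpa [Function.comp_def] using h

/-- The angular derivative field at the identity of `θ ↦ q ∘ R_{−θ}` is `y ↦ −Dq(y)[J y]`. -/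
theorem deriv_comp_rotZ_neg_zero_eq {F : Type*} [NormedAddCommGroup F] [NormedSpace ℝ F]
    {q : ℝ³ → F} (hq : Differentiable ℝ q) :
    (fun y => deriv (fun φ => q (rotZ (-φ) y)) 0) = fun y => -(fderiv ℝ q y (rotGen y)) :=
  funext fun y => (hasDerivAt_comp_rotZ_neg_zero y (hq y)).deriv

/-! ## Joint smoothness of the conjugation orbits (angle as the "time" of a two-parameter field) -/

/-- The conjugation orbit `(θ, y) ↦ R_θ f(R_{−θ} y)` of a smooth field is jointly smooth in the angle and
the point (a two-parameter field on the "time" set `univ` of angles). -/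
theorem isSmoothSpaceTimeOn_rotConj_angle {f : ℝ³ → ℝ³} (hf : ContDiff ℝ ∞ f) :
    IsSmoothSpaceTimeOn univ (fun θ y => rotZ θ (f (rotZ (-θ) y))) := by
  have h : ContDiff ℝ ∞ (fun p : ℝ × ℝ³ => rotZ p.1 (f (rotZ (-p.1) p.2))) :=
    contDiff_rotZ_angleVector contDiff_fst
      (hf.comp (contDiff_rotZ_angleVector contDiff_fst.neg contDiff_snd))
  exact h.contDiffOn

/-- The scalar orbit `(θ, y) ↦ q(R_{−θ} y)` of a smooth function is jointly smooth in the angle and the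
point. -/
theorem isSmoothSpaceTimeOn_comp_rotZ_neg_angle {F : Type*} [NormedAddCommGroup F] [NormedSpace ℝ F]
    {q : ℝ³ → F} (hq : ContDiff ℝ ∞ q) :
    IsSmoothSpaceTimeOn univ (fun θ y => q (rotZ (-θ) y)) := by
  have h : ContDiff ℝ ∞ (fun p : ℝ × ℝ³ => q (rotZ (-p.1) p.2)) :=
    hq.comp (contDiff_rotZ_angleVector contDiff_fst.neg contDiff_snd)
  exact h.contDiffOn

/-- At a fixed point `x`, the conjugation orbit `(s, θ) ↦ R_θ V(s, R_{−θ} x)` of a field jointly smooth on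
the time set `S` is jointly smooth in time and angle on `S`. -/
theorem isSmoothSpaceTimeOn_rotConj_timeAngle {S : Set ℝ} {V : ℝ → ℝ³ → ℝ³}
    (hV : IsSmoothSpaceTimeOn S V) (x : ℝ³) :
    IsSmoothSpaceTimeOn S (fun s θ => rotZ θ (V s (rotZ (-θ) x))) := by
  have hΦ : ContDiff ℝ ∞ (fun p : ℝ × ℝ => (p.1, rotZ (-p.2) x)) :=
    contDiff_fst.prodMk (contDiff_rotZ_angleVector contDiff_snd.neg contDiff_const)
  have h1 : ContDiffOn ℝ ∞ (uncurry V ∘ fun p : ℝ × ℝ => (p.1, rotZ (-p.2) x)) (S ×ˢ univ) :=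
    hV.comp hΦ.contDiffOn (fun p hp => ⟨hp.1, mem_univ _⟩)
  exact contDiffOn_rotZ_angleVector contDiffOn_snd h1

/-! ## Angular derivatives at the identity of the terms of the conjugated equations -/

/-- **`∂_θ|₀ ∇V^θ = ∇r`**: the slice derivative of the conjugation orbit of a smooth field has angular
derivative at the identity the derivative of the rotation generator (exchange of `∂_θ` and `D`,
operator-valued). -/
theorem hasDerivAt_fderiv_rotConj_zero {f : ℝ³ → ℝ³} (hf : ContDiff ℝ ∞ f) (x : ℝ³) :
    HasDerivAt (fun θ => fderiv ℝ (fun y => rotZ θ (f (rotZ (-θ) y))) x)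
      (fderiv ℝ (fun y => rotGen (f y) - fderiv ℝ f y (rotGen y)) x) 0 := by
  have h := (isSmoothSpaceTimeOn_rotConj_angle hf).hasDerivAt_fderiv_slice_clm isOpen_univ
    (mem_univ (0 : ℝ)) x
  rw [deriv_rotConj_zero_eq (hf.differentiable (by simp))] at h
  exact h

/-- **`∂_θ|₀ ΔV^θ = Δr`** (exchange of `∂_θ` and `D²`, then the trace over the standard basis). -/
theorem hasDerivAt_laplacian_rotConj_zero {f : ℝ³ → ℝ³} (hf : ContDiff ℝ ∞ f) (x : ℝ³) :
    HasDerivAt (fun θ => (Δ (fun y => rotZ θ (f (rotZ (-θ) y)))) x)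
      ((Δ (fun y => rotGen (f y) - fderiv ℝ f y (rotGen y))) x) 0 := by
  have h := hasDerivAt_iteratedFDeriv_slice (isSmoothSpaceTimeOn_rotConj_angle hf) isOpen_univ 2 0
    (mem_univ _) x
  rw [deriv_rotConj_zero_eq (hf.differentiable (by simp))] at h
  simp only [InnerProductSpace.laplacian_eq_iteratedFDeriv_orthonormalBasis _
    (EuclideanSpace.basisFun (Fin 3) ℝ)]
  refine HasDerivAt.fun_sum fun i _ => ?_
  have := (ContinuousMultilinearMap.apply ℝ (fun _ : Fin 2 => ℝ³) ℝ³
    ![EuclideanSpace.basisFun (Fin 3) ℝ i, EuclideanSpace.basisFun (Fin 3) ℝ i]).hasFDerivAt.comp_hasDerivAt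
    (0 : ℝ) h
  simpa [Function.comp_def] using this

/-- **`∂_θ|₀ div V^θ = div r`** (the divergence is the trace of the slice derivative). -/
theorem hasDerivAt_divergence_rotConj_zero {f : ℝ³ → ℝ³} (hf : ContDiff ℝ ∞ f) (x : ℝ³) :
    HasDerivAt (fun θ => VectorCalculus.divergence (fun y => rotZ θ (f (rotZ (-θ) y))) x)
      (VectorCalculus.divergence (fun y => rotGen (f y) - fderiv ℝ f y (rotGen y)) x) 0 := by
  have h := hasDerivAt_fderiv_rotConj_zero hf x
  simp only [divergence_eq_sum_inner_fderiv (EuclideanSpace.basisFun (Fin 3) ℝ)]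
  refine HasDerivAt.fun_sum fun i _ => ?_
  have h1 := (ContinuousLinearMap.apply ℝ ℝ³
    (EuclideanSpace.basisFun (Fin 3) ℝ i)).hasFDerivAt.comp_hasDerivAt (0 : ℝ) h
  have h2 := (innerSL ℝ (EuclideanSpace.basisFun (Fin 3) ℝ i)).hasFDerivAt.comp_hasDerivAt (0 : ℝ) h1
  simpa [Function.comp_def] using h2

/-- **`∂_θ|₀ (V^θ·∇)V^θ = (V·∇)r + (r·∇)V`**: the nonlinearity differentiates as a product
(`(u·∇)u (x) = Du(x)[u(x)]`, product rule for the evaluation of an operator-valued curve). -/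
theorem hasDerivAt_convect_rotConj_zero {f : ℝ³ → ℝ³} (hf : ContDiff ℝ ∞ f) (x : ℝ³) :
    HasDerivAt
      (fun θ => convect (fun y => rotZ θ (f (rotZ (-θ) y))) (fun y => rotZ θ (f (rotZ (-θ) y))) x)
      (convect f (fun y => rotGen (f y) - fderiv ℝ f y (rotGen y)) x +
        convect (fun y => rotGen (f y) - fderiv ℝ f y (rotGen y)) f x) 0 := by
  have h1 := hasDerivAt_fderiv_rotConj_zero hf x
  have h2 := hasDerivAt_rotConj_zero x ((hf.differentiable (by simp)) x)
  simpa using h1.clm_apply h2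

/-- **`∂_θ|₀ ∇(Q ∘ R_{−θ}) = ∇P_r`**, `P_r = −DQ·(J·)` (exchange of `∂_θ` and `D`, then the Riesz map). -/
theorem hasDerivAt_gradient_comp_rotZ_neg_zero {q : ℝ³ → ℝ} (hq : ContDiff ℝ ∞ q) (x : ℝ³) :
    HasDerivAt (fun θ => gradient (fun y => q (rotZ (-θ) y)) x)
      (gradient (fun y => -(fderiv ℝ q y (rotGen y))) x) 0 := by
  have h := (isSmoothSpaceTimeOn_comp_rotZ_neg_angle hq).hasDerivAt_fderiv_slice_clm isOpen_univ
    (mem_univ (0 : ℝ)) x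
  rw [deriv_comp_rotZ_neg_zero_eq (hq.differentiable (by simp))] at h
  unfold gradient
  have := (InnerProductSpace.toDual ℝ ℝ³).symm.toContinuousLinearEquiv.hasFDerivAt.comp_hasDerivAt
    (0 : ℝ) h
  simpa [Function.comp_def] using this

/-- **`∂_θ|₀ ∂ₜV^θ = ∂ₜr`** at every time of an open time set (Schwarz for the jointly smooth
two-parameter field `(s, θ) ↦ R_θ V(s, R_{−θ} x)`). -/
theorem hasDerivAt_timeDeriv_rotConj_zero {S : Set ℝ} {V : ℝ → ℝ³ → ℝ³}
    (hV : IsSmoothSpaceTimeOn S V) (hS : IsOpen S) {t : ℝ} (ht : t ∈ S) (x : ℝ³) :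
    HasDerivAt (fun θ => deriv (fun s => rotZ θ (V s (rotZ (-θ) x))) t)
      (deriv (fun s => rotGen (V s x) - fderiv ℝ (V s) x (rotGen x)) t) 0 := by
  have hu := isSmoothSpaceTimeOn_rotConj_timeAngle hV x
  have hex := hu.deriv_fderiv_slice_eq_fderiv_deriv hS ht (0 : ℝ) (1 : ℝ)
  simp only [fderiv_apply_one_eq_deriv] at hex
  -- the angular derivative at `0` is the generator, at every time of `S`
  have hin : (fun s => deriv (fun θ => rotZ θ (V s (rotZ (-θ) x))) 0) =ᶠ[𝓝 t]
      fun s => rotGen (V s x) - fderiv ℝ (V s) x (rotGen x) := by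
    filter_upwards [hS.mem_nhds ht] with s hs
    exact (hasDerivAt_rotConj_zero x (((hV.contDiff_slice hs).differentiable (by simp)) x)).deriv
  rw [hin.deriv_eq] at hex
  -- the angular line of the time derivative is differentiable (the time derivative is jointly smooth)
  have hd : DifferentiableAt ℝ (fun θ => deriv (fun s => rotZ θ (V s (rotZ (-θ) x))) t) 0 :=
    (((hu.isSmoothSpaceTimeOn_deriv hS).contDiff_slice ht).differentiable (by simp)) 0
  rw [hex]
  exact hd.hasDerivAt

/-! ## The registered stub -/

/-- **STUB P1: the rotation generator solves the linearised system.**  For a classical solution `(V, Q)` of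
Navier–Stokes on `(−∞,0) × ℝ³`, the rotation generator `r = J V − ∇V·(J x)` (`J = rotGen`) with the pressure
`−∇Q·(J x)` is jointly smooth, divergence-free and solves `∂ₜr + (V·∇)r + (r·∇)V = Δr − ∇(−∇Q·(Jx))`
(differentiate at `θ = 0` the momentum equation and the incompressibility of the rotation conjugates
`(R_θ V(t,R_{−θ}·), Q(t,R_{−θ}·))`, which are classical solutions by isometry covariance). -/
theorem stub_rotationGeneratorSolvesLinearised :
    ∀ (V : ℝ → ℝ³ → ℝ³) (Q : ℝ → ℝ³ → ℝ), IsClassicalNSSolutionOn (Iio (0 : ℝ)) 1 0 V Q →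
      IsSmoothSpaceTimeOn (Iio (0 : ℝ)) (fun t x => rotGen (V t x) - fderiv ℝ (V t) x (rotGen x)) ∧
      IsSmoothSpaceTimeOn (Iio (0 : ℝ)) (fun t x => -(fderiv ℝ (Q t) x (rotGen x))) ∧
      (∀ t < 0, VectorCalculus.IsDivFree (fun x => rotGen (V t x) - fderiv ℝ (V t) x (rotGen x))) ∧
      (∀ t < 0, ∀ x : ℝ³,
        deriv (fun s => rotGen (V s x) - fderiv ℝ (V s) x (rotGen x)) t
          + convect (V t) (fun y => rotGen (V t y) - fderiv ℝ (V t) y (rotGen y)) x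
          + convect (fun y => rotGen (V t y) - fderiv ℝ (V t) y (rotGen y)) (V t) x =
        (Δ (fun y => rotGen (V t y) - fderiv ℝ (V t) y (rotGen y))) x
          - gradient (fun y => -(fderiv ℝ (Q t) y (rotGen y))) x) := by
  intro V Q hcl
  have hU : UniqueDiffOn ℝ (Iio (0 : ℝ)) := isOpen_Iio.uniqueDiffOn
  have hV : IsSmoothSpaceTimeOn (Iio (0 : ℝ)) V := hcl.smooth_velocity
  have hQ : IsSmoothSpaceTimeOn (Iio (0 : ℝ)) Q := hcl.smooth_pressure
  have hJ : IsSmoothSpaceTimeOn (Iio (0 : ℝ)) (fun (_ : ℝ) (x : ℝ³) => rotGen x) :=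
    isSmoothSpaceTimeOn_const_time rotGenL.contDiff _
  -- the conjugated classical solutions
  have hclθ : ∀ θ : ℝ, IsClassicalNSSolutionOn (Iio (0 : ℝ)) 1
      (fun t x => rotZLIE θ ((0 : ℝ → ℝ³ → ℝ³) t ((rotZLIE θ).symm x)))
      (fun t x => rotZLIE θ (V t ((rotZLIE θ).symm x))) (fun t x => Q t ((rotZLIE θ).symm x)) :=
    fun θ => hcl.conj_linearIsometryEquiv (rotZLIE θ) hU
  refine ⟨?_, ?_, ?_, ?_⟩
  · -- joint smoothness of the generator
    have h1 : IsSmoothSpaceTimeOn (Iio (0 : ℝ)) (fun t x => rotGenL (V t x)) := hV.clm rotGenL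
    have h2 : IsSmoothSpaceTimeOn (Iio (0 : ℝ)) (fun t x => fderiv ℝ (V t) x (rotGen x)) :=
      (hV.fderiv_slice hU).clm_apply hJ
    simpa only [rotGenL_apply] using h1.sub h2
  · -- joint smoothness of the pressure
    have h3 : IsSmoothSpaceTimeOn (Iio (0 : ℝ)) (fun t x => fderiv ℝ (Q t) x (rotGen x)) :=
      (hQ.fderiv_slice hU).clm_apply hJ
    exact ContDiffOn.neg h3
  · -- incompressibility: differentiate `div V^θ(t) ≡ 0` at `θ = 0`
    intro t ht x
    have hVt : ContDiff ℝ ∞ (V t) := hV.contDiff_slice ht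
    have hz : (fun θ : ℝ => VectorCalculus.divergence (fun y => rotZ θ (V t (rotZ (-θ) y))) x) =
        fun _ => 0 :=
      funext fun θ => (hclθ θ).divFree t ht x
    have h := hasDerivAt_divergence_rotConj_zero hVt x
    rw [hz] at h
    exact h.unique (hasDerivAt_const (0 : ℝ) (0 : ℝ))
  · -- the linearised momentum equation: differentiate the conjugated momentum equation at `θ = 0`
    intro t ht x
    have hVt : ContDiff ℝ ∞ (V t) := hV.contDiff_slice ht
    have hQt : ContDiff ℝ ∞ (Q t) := hQ.contDiff_slice ht
    have hmom : (fun θ : ℝ => deriv (fun s => rotZ θ (V s (rotZ (-θ) x))) t +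
        convect (fun y => rotZ θ (V t (rotZ (-θ) y))) (fun y => rotZ θ (V t (rotZ (-θ) y))) x) =
        fun θ => (Δ (fun y => rotZ θ (V t (rotZ (-θ) y)))) x
          - gradient (fun y => Q t (rotZ (-θ) y)) x := by
      funext θ
      have h := (hclθ θ).momentum t ht x
      rw [timeDerivWithin_eq_deriv isOpen_Iio ht] at h
      simpa only [rotZLIE_apply, rotZLIE_symm_apply, one_smul, Pi.zero_apply, map_zero, add_zero]
        using h
    have hL := (hasDerivAt_timeDeriv_rotConj_zero hV isOpen_Iio ht x).fun_add
      (hasDerivAt_convect_rotConj_zero hVt x)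
    rw [hmom] at hL
    have hR := (hasDerivAt_laplacian_rotConj_zero hVt x).fun_sub
      (hasDerivAt_gradient_comp_rotZ_neg_zero hQt x)
    have h := hL.unique hR
    rw [← add_assoc] at h
    exact h

end Summit.NavierStokesRegularity.NavierStokesRegularity.Theorems.RellichScarScarRigidity
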